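import Summits.QuantumFields.BalabanUV.Beta.EriceRemainderEnclosureHistoryAutonomyComparisonAgeCompositionStaticEndOldest
import Summits.QuantumFields.BalabanUV.Beta.EriceRemainderEnclosureHistoryAutonomyComparisonAgeCompositionYoungestTailSumWiring

/-!
# EriceRemainderEnclosureHistoryAutonomyComparisonAgeCompositionStaticEndOldestFlow — (E82e) route (N), first order: (E82d)'s END FOR THE FLOW, and the
# TWO-AGE END with everything provable-or-measured: the youngest member of (S-b) DISCHARGED ((E82b)∕(E82c)), the silent ages trivial, the old age on the
# second-order read-decay criterion (margin ≈ 0.17 along flows), (S-a) for the old age and (S-c♯) displayed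

Cell `pub-balaban`, β-function sub-cell, BINDER row D4 «RemainderConst leaves for Bałaban's split» (`HOME/BINDER-OWNERS.md`; owner lineage `b2b-balaban-beta-an4`;
this file by co-owner #2 lineage `b2b-balaban-beta-d4-p2`, generation 73), β-FLOW TEAM duty (1), FREEZE (0) honoured (def-free; imports (E82d) `…StaticEndOldest`
and (E82c) `…YoungestTailSumWiring`; uses (E75a), (E80e), (E81d), (E81i), (E82c), (E82d) BY NAME; the wrapper is (E81k)'s with one hypothesis exchanged).

HONEST FRAMING (page 1, verbatim and binding).  *"Discharging BetaPertH makes Bałaban's UV stability UNCONDITIONAL — a real constructive-QFT result; it is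
NOT the continuum limit and NOT the Clay problem."*  THIS FILE DISCHARGES NOTHING OF THE KIND.  Elementary real analysis about ABSTRACT functionals on a box
]0,γ]^ℕ with displayed floors, profiles and signs, and the FIRST-ORDER renewal objects of route (N) built from them — hypotheses of a census, not facts; the
form, signs, ages and moments of Bałaban's (1.22) limit functional are NOT PRINTED ([I] p. 298; GAPS G-t4-U2-1∕-2) and NOT asserted.  Row D4 class
UNCHANGED (critical-path width 0; instance 0∕1; D4 DISCHARGE NO DATE).  HONEST DEPENDENCY: continuum YM on T⁴ ⇐ BetaPertH ∧ nine spine estimates (0/9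
proved); BetaPertH ⇐ (D1) ∧ (D4) ∧ CAP+tail; G-an2-4 gates asym, D1 and NE2/3/4.

THE POINT (census sense (α); route (N); README `g73/e82/README.md` §5).  §1 **`flow_nonneg_of_static_families_oldest`**: (E81k) `flow_nonneg_of_sharp_static_families`
with the tail sums (S-b) asked only for the ages `< K − 1` and the oldest age `K − 1` on (E82d)'s second-order criterion `hold2`.  §2 the silent ages of a
profile satisfy (S-a) and (S-b) trivially (`silent_row`, `silent_tail_sums`).  §3 **`flow_nonneg_two_ages_oldest`**: for a two-age profile `{1, k}` with
`K = k + 1` (the old age IS the oldest index), the first-order comparison surplus is non-negative for every admissible excess along every box solution and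
every damping in the relaxed class, GIVEN ONLY: (S-a) for the age `k` (`hrowk`: its damped row mass non-increasing in the pin — numerics ≤ 0.997 lone,
thin under a saturated young age), the second-order criterion for the age `k` (`hold2` — numerics 0.68–0.84, `g73/numerics/n17`), and (S-c♯) (`hSc`,
`hScp` — g72 m21: ≤ 0.9905).  The youngest member of (S-b) is no longer a hypothesis ((E82b)∕(E82c)).  NOT CLAIMED: the three displayed families for the
flow; three or more ages; anything nonlinear; anything printed.

WHAT IS PROVED ([folklore]; 0 `def`, 0 sorry).  §1 **`flow_nonneg_of_static_families_oldest`**; §2 `silent_row`, `silent_tail_sums`; §3 **`flow_nonneg_two_ages_oldest`**.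
-/
noncomputable section
open Finset

namespace Summit.QuantumFields.BalabanUV.Beta.EriceRemainderEnclosureHistoryAutonomyComparisonAgeCompositionStaticEndOldestFlow

open Literature.MathematicalPhysics.QuantumFieldTheory.Balaban1983to89
open Literature.MathematicalPhysics.QuantumFieldTheory.Balaban1983to89.T4BetaStationary
open Literature.MathematicalPhysics.QuantumFieldTheory.Balaban1983to89.T4BetaFlowWellPosed
open Summit.QuantumFields.BalabanUV.Beta.EriceRemainderEnclosureHistoryAutonomyOrder (strictAnti_of_memFlow)
open Summit.QuantumFields.BalabanUV.Beta.EriceRemainderEnclosureHistoryAutonomyComparisonAgeCompositionIdentification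
open Summit.QuantumFields.BalabanUV.Beta.EriceRemainderEnclosureHistoryAutonomyComparisonAgeCompositionChainWiringAtPin
open Summit.QuantumFields.BalabanUV.Beta.EriceRemainderEnclosureHistoryAutonomyComparisonAgeCompositionCriteriaFlow
open Summit.QuantumFields.BalabanUV.Beta.EriceRemainderEnclosureHistoryAutonomyComparisonAgeCompositionStaticEndFlow
open Summit.QuantumFields.BalabanUV.Beta.EriceRemainderEnclosureHistoryAutonomyComparisonAgeCompositionStaticEndOldest
open Summit.QuantumFields.BalabanUV.Beta.EriceRemainderEnclosureHistoryAutonomyComparisonAgeCompositionYoungestTailSumWiring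

variable {B : (ℕ → ℝ) → ℝ} {γ b gIR : ℝ} {L : ℕ → ℝ} {K : ℕ} {h g : ℕ → ℝ} {KL : ℕ → ℕ → ℕ → ℝ}

/-! ## §1 (E82d)'s END for the flow -/

/-- **ROUTE (N), FIRST ORDER, END FOR THE FLOW — MODULO (S-a), (S-c♯), (S-b) FOR THE AGES `< K−1`, AND THE SECOND-ORDER CRITERION FOR THE OLDEST AGE.**
As (E81k) `flow_nonneg_of_sharp_static_families`, with `hSb`∕`hSbp` asked only for the ages `i < K − 1` and, for the oldest age `K − 1`, the second-order
read-decay criterion of (E81a) for the truncations (`hold2`; (E82d) `nonneg_of_static_families_oldest`). [folklore] -/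
theorem flow_nonneg_of_static_families_oldest (hmono : ∀ u v : ℕ → ℝ, SeqBox γ u → SeqBox γ v → (∀ j, u j ≤ v j) → B u ≤ B v)
    (hL : ∀ k, 0 ≤ L k) (hb : 0 < b) (hlo : ∀ u, SeqBox γ u → b ≤ B u) (hdom : ∀ u, SeqBox γ u → ∑ k ∈ range K, L k * u k ≤ B u)
    (hh : SeqBox γ h) (hf : MemFlow B gIR h)
    (hg : ∀ t, 0 < g t ∧ g t ≤ 1) (hgF : ∀ t, 1 / (1 + ∑ k ∈ range K, L k * h (t + k) ^ 3 / 2) ≤ g t) (hK : 2 ≤ K)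
    (hKL : ∀ k n l, KL k n l = if 0 < k ∧ k < K ∧ l < k then L k * h (n + k) ^ 3 / 2 * ∏ t ∈ Ico (n + 1 + l) (n + k + 1), g t else 0)
    {θ : ℕ → ℕ → ℕ → ℝ} (hθ : ∀ k n l, θ k n l = 1 - (h (n + k + l) / h (n + k)) ^ 3 * ∏ t ∈ Ico (n + k + 1) (n + k + l + 1), g t)
    {KA : ℕ → ℕ → ℕ → ℝ} {RL RA SL SA : ℕ → (ℕ → ℝ) → ℕ → ℝ}
    (hRL : ∀ i v m, RL i v m = ∑ l ∈ range K, KL i m l * v (m + 1 + l))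
    (hRA : ∀ i v m, RA i v m = ∑ l ∈ range K, KA i m l * v (m + 1 + l))
    (hKA : ∀ i m l, KA i m l = KL i m l + KA (i + 1) m l) (hKAtop : ∀ m l, KA K m l = 0)
    (hSL : ∀ i (w : ℕ → ℝ), (∀ m, K < m → w m = 0) → (∀ m, K < m → SL i w m = 0) ∧ ∀ m, SL i w m = w m - RL i (SL i w) m)
    (hSA : ∀ i (w : ℕ → ℝ), (∀ m, K < m → w m = 0) → (∀ m, K < m → SA i w m = 0) ∧ ∀ m, SA i w m = w m - RA i (SA i w) m)
    {ρ : ℕ → ℕ → ℝ} {β : ℕ → ℕ → ℕ → ℝ}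
    (hρ : ∀ i n, 1 ≤ i → i ≤ K - 1 → ρ i n = (∑ l ∈ range K, KL i n l) * (1 + ∑ k ∈ Ioc i (K - 1), θ k n i * β (i + 1) n k) /
      (1 - ∑ k ∈ Ioc i (K - 1), ∑ l ∈ range i, KL k n l))
    (hβnew : ∀ i n, 1 ≤ i → i ≤ K - 1 → β i n i = ρ i n / (1 - ρ i n))
    (hβold : ∀ i n k, 1 ≤ i → i < k → k ≤ K - 1 → β i n k = β (i + 1) n k / (1 - ρ i n))
    (hrow : ∀ k n, 2 ≤ k → k < K → ∑ l ∈ range k, KL k (n + 1) l ≤ ∑ l ∈ range k, KL k n l)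
    {Hg : ℕ → ℕ → ℝ} (hH : ∀ i m, Hg i m = (1 + ∑ k ∈ Ioc i (K - 1), θ k m 1 * β (i + 1) m k) / (1 - ∑ k ∈ Ioc i (K - 1), KL k m 0))
    {M : ℕ → ℕ → ℝ} (hM : ∀ i m, M i m = KL i m 0 + ∑ l ∈ range (K - 1), max (KL i m (l + 1) - KL i (m + 1) l) 0)
    (hSb : ∀ i m, 1 ≤ i → i < K - 1 → ∀ L', L' < i →
      (1 + M i m) * ∑ l ∈ Ico L' i, Hg i (m + 1 + l) * KL i (m + 1) l ≤ ∑ l ∈ Ico L' i, KL i m l)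
    (hSbp : ∀ i m, 1 ≤ i → i < K - 1 → ∀ L₀, L₀ < i → ∀ L', L' ≤ L₀ →
      (1 + M i m) * ∑ l ∈ Ico L' L₀, Hg i (m + 1 + l) * KL i (m + 1) l ≤ ∑ l ∈ Ico L' (L₀ + 1), KL i m l)
    (hold2 : ∀ j, j ≤ K → ∀ n', M (K - 1) n' * (RL (K - 1) (fun m => if m ≤ j then (1:ℝ) else 0) (n' + 1) -
        RL (K - 1) (fun m => RL (K - 1) (fun m => if m ≤ j then (1:ℝ) else 0) m -
          RL (K - 1) (RL (K - 1) (fun m => if m ≤ j then (1:ℝ) else 0)) m) (n' + 1)) ≤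
      RL (K - 1) (fun m => if m ≤ j then (1:ℝ) else 0) n' - RL (K - 1) (fun m => if m ≤ j then (1:ℝ) else 0) (n' + 1))
    {HgS : ℕ → ℕ → ℕ → ℝ} (hHS : ∀ i j m, HgS i j m = (1 + ∑ k ∈ Ioc i (K - 1), θ k m 1 * β (i + 1) m k) /
      (1 - ∑ k ∈ Ioc i (K - 1), (KL k m 0 - if m + 1 + k ≤ j then KL k (m + 1) (k - 1) else 0)))
    (hSc : ∀ i m j, 1 ≤ i → i ≤ K - 1 → m + 1 + K ≤ j → ∀ L', L' < K →
      ∑ l ∈ Ico L' K, HgS (i - 1) j (m + 1 + l) * KA i (m + 1) l ≤ ∑ l ∈ Ico L' K, KA i m l)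
    (hScp : ∀ i m L₀, 1 ≤ i → i ≤ K - 1 → L₀ < K → ∀ L', L' ≤ L₀ →
      ∑ l ∈ Ico L' L₀, HgS (i - 1) (m + 1 + L₀) (m + 1 + l) * KA i (m + 1) l ≤ ∑ l ∈ Ico L' (L₀ + 1), KA i m l)
    {e ε : ℕ → ℝ} (he0 : ∀ m, 0 ≤ e m) (hea : ∀ m, e (m + 1) ≤ e m) (het : ∀ m, K < m → e m = 0)
    (hεt : ∀ m, K < m → ε m = 0) (hεrec : ∀ m, ε m = e m - RA 1 ε m) : ∀ m, 0 ≤ ε m := by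
  have hh0 : ∀ n, 0 < h n := fun n => (hh n).1
  have hanti := (strictAnti_of_memFlow hb hlo hh hf).antitone
  have hac := fun n i (hi1 : 1 ≤ i) (hiK : i ≤ K - 1) =>
    age_chain_closes hmono hL hb hlo hdom hh hf hg hgF hKL hθ hρ hβnew hβold n hi1 hiK
  have hcumL : ∀ k, 1 ≤ k → k ≤ K - 1 → ∀ m M', ∑ l ∈ range (M' + 1), KL k (m + 1) l ≤ ∑ l ∈ range (M' + 2), KL k m l := by
    intro k hk1 hkK m M'
    refine flow_cum_dom_of_rowmass hL hh0 hanti hg hKL (fun n => ?_) m M'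
    rcases Nat.lt_or_ge k 2 with hk2 | hk2
    · have : k = 1 := by omega
      subst this
      exact flow_rowmass_one hmono hL hb hlo hdom hh hf hg hgF hK hKL n
    · exact hrow k n hk2 (by omega)
  exact nonneg_of_static_families_oldest (N := K) (n := K - 1) (y := fun i => i) (KL := KL) (θ := θ)
    (weight_nonneg hL hh0 hg hKL) (weight_eq_zero_of_horizon hKL)
    (fun i m l hl => by rw [hKL, if_neg (fun h3 => by omega)])
    hRL hRA hKA (fun m l => by rw [Nat.sub_add_cancel (by omega : 1 ≤ K)]; exact hKAtop m l) hSL hSA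
    (fun i hi1 hiK => ⟨hi1, by omega⟩)
    (defect_nonneg hh0 hanti hg hθ) (persistence hL hh0 hg hKL hθ) (fun k m l l' hll' => defect_mono hh0 hanti hg hθ k m hll')
    hρ hβnew hβold (fun i m hi1 hiK => (hac m i hi1 hiK).2) (fun i m hi1 hiK => (hac m i hi1 hiK).1) hcumL
    (fun i m _ => flow_lag_zero_mass_lt_one hmono hL hb hlo hdom hh hf hg hKL i m) hH hM hSb hSbp hold2 hHS hSc hScp he0 hea het hεt hεrec

/-! ## §2 Silent ages satisfy (S-a) and (S-b) trivially -/

/-- A silent age (`L_k = 0`) has non-increasing (zero) row masses. [folklore] -/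
theorem silent_row
    (hKL : ∀ k n l, KL k n l = if 0 < k ∧ k < K ∧ l < k then L k * h (n + k) ^ 3 / 2 * ∏ t ∈ Ico (n + 1 + l) (n + k + 1), g t else 0)
    {k : ℕ} (hk : L k = 0) (n : ℕ) : ∑ l ∈ range k, KL k (n + 1) l ≤ ∑ l ∈ range k, KL k n l := by
  rw [sum_eq_zero fun l _ => kernel_zero hKL hk (n + 1) l, sum_eq_zero fun l _ => kernel_zero hKL hk n l]

/-- A silent age satisfies every tail-sum inequality of (S-b) (both sides vanish). [folklore] -/
theorem silent_tail_sums
    (hKL : ∀ k n l, KL k n l = if 0 < k ∧ k < K ∧ l < k then L k * h (n + k) ^ 3 / 2 * ∏ t ∈ Ico (n + 1 + l) (n + k + 1), g t else 0)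
    {i : ℕ} (hi : L i = 0) {Hg M : ℕ → ℕ → ℝ} (m : ℕ) (s s' : Finset ℕ) :
    (1 + M i m) * ∑ l ∈ s, Hg i (m + 1 + l) * KL i (m + 1) l ≤ ∑ l ∈ s', KL i m l := by
  rw [sum_eq_zero fun l _ => by rw [kernel_zero hKL hi (m + 1) l, mul_zero], mul_zero, sum_eq_zero fun l _ => kernel_zero hKL hi m l]

/-! ## §3 The two-age END on provable-or-measured hypotheses -/

/-- **ROUTE (N), FIRST ORDER, END FOR TWO-AGE FLOWS — THE YOUNGEST (S-b) DISCHARGED, THE OLD AGE ON THE SECOND-ORDER CRITERION.**  `B` isotone with floor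
`b > 0` dominated by a two-age profile (`L_j = 0` for `j ∉ {1, k}`, `2 ≤ k`, horizon `K = k + 1`); `h` a box solution; `g` any damping in the relaxed class;
the first-order objects of route (N) as in (E81k).  HYPOTHESES LEFT (each a kernel inequality, each true along every flow tested): `hrowk` — (S-a) for the age
`k`; `hold2` — the second-order read-decay criterion for the age `k` and the truncations; `hSc`, `hScp` — (S-c♯).  CONCLUSION: the comparison surplus `ε` of
every admissible excess `e` is non-negative.  ((S-b) at the age `1`: (E82c) `flow_hSb_one`; at the silent ages: `silent_tail_sums`.) [folklore] -/
theorem flow_nonneg_two_ages_oldest (hmono : ∀ u v : ℕ → ℝ, SeqBox γ u → SeqBox γ v → (∀ j, u j ≤ v j) → B u ≤ B v)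
    (hL : ∀ k, 0 ≤ L k) (hb : 0 < b) (hlo : ∀ u, SeqBox γ u → b ≤ B u) (hdom : ∀ u, SeqBox γ u → ∑ k ∈ range K, L k * u k ≤ B u)
    (hh : SeqBox γ h) (hf : MemFlow B gIR h)
    (hg : ∀ t, 0 < g t ∧ g t ≤ 1) (hgF : ∀ t, 1 / (1 + ∑ k ∈ range K, L k * h (t + k) ^ 3 / 2) ≤ g t)
    {k : ℕ} (hk2 : 2 ≤ k) (hKk : K = k + 1) (hL2 : ∀ j, j < K → j ≠ 1 → j ≠ k → L j = 0)
    (hKL : ∀ k n l, KL k n l = if 0 < k ∧ k < K ∧ l < k then L k * h (n + k) ^ 3 / 2 * ∏ t ∈ Ico (n + 1 + l) (n + k + 1), g t else 0)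
    {θ : ℕ → ℕ → ℕ → ℝ} (hθ : ∀ k n l, θ k n l = 1 - (h (n + k + l) / h (n + k)) ^ 3 * ∏ t ∈ Ico (n + k + 1) (n + k + l + 1), g t)
    {KA : ℕ → ℕ → ℕ → ℝ} {RL RA SL SA : ℕ → (ℕ → ℝ) → ℕ → ℝ}
    (hRL : ∀ i v m, RL i v m = ∑ l ∈ range K, KL i m l * v (m + 1 + l))
    (hRA : ∀ i v m, RA i v m = ∑ l ∈ range K, KA i m l * v (m + 1 + l))
    (hKA : ∀ i m l, KA i m l = KL i m l + KA (i + 1) m l) (hKAtop : ∀ m l, KA K m l = 0)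
    (hSL : ∀ i (w : ℕ → ℝ), (∀ m, K < m → w m = 0) → (∀ m, K < m → SL i w m = 0) ∧ ∀ m, SL i w m = w m - RL i (SL i w) m)
    (hSA : ∀ i (w : ℕ → ℝ), (∀ m, K < m → w m = 0) → (∀ m, K < m → SA i w m = 0) ∧ ∀ m, SA i w m = w m - RA i (SA i w) m)
    {ρ : ℕ → ℕ → ℝ} {β : ℕ → ℕ → ℕ → ℝ}
    (hρ : ∀ i n, 1 ≤ i → i ≤ K - 1 → ρ i n = (∑ l ∈ range K, KL i n l) * (1 + ∑ k ∈ Ioc i (K - 1), θ k n i * β (i + 1) n k) /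
      (1 - ∑ k ∈ Ioc i (K - 1), ∑ l ∈ range i, KL k n l))
    (hβnew : ∀ i n, 1 ≤ i → i ≤ K - 1 → β i n i = ρ i n / (1 - ρ i n))
    (hβold : ∀ i n k, 1 ≤ i → i < k → k ≤ K - 1 → β i n k = β (i + 1) n k / (1 - ρ i n))
    (hrowk : ∀ n, ∑ l ∈ range k, KL k (n + 1) l ≤ ∑ l ∈ range k, KL k n l)
    {Hg : ℕ → ℕ → ℝ} (hH : ∀ i m, Hg i m = (1 + ∑ k ∈ Ioc i (K - 1), θ k m 1 * β (i + 1) m k) / (1 - ∑ k ∈ Ioc i (K - 1), KL k m 0))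
    {M : ℕ → ℕ → ℝ} (hM : ∀ i m, M i m = KL i m 0 + ∑ l ∈ range (K - 1), max (KL i m (l + 1) - KL i (m + 1) l) 0)
    (hold2 : ∀ j, j ≤ K → ∀ n', M k n' * (RL k (fun m => if m ≤ j then (1:ℝ) else 0) (n' + 1) -
        RL k (fun m => RL k (fun m => if m ≤ j then (1:ℝ) else 0) m - RL k (RL k (fun m => if m ≤ j then (1:ℝ) else 0)) m) (n' + 1)) ≤
      RL k (fun m => if m ≤ j then (1:ℝ) else 0) n' - RL k (fun m => if m ≤ j then (1:ℝ) else 0) (n' + 1))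
    {HgS : ℕ → ℕ → ℕ → ℝ} (hHS : ∀ i j m, HgS i j m = (1 + ∑ k ∈ Ioc i (K - 1), θ k m 1 * β (i + 1) m k) /
      (1 - ∑ k ∈ Ioc i (K - 1), (KL k m 0 - if m + 1 + k ≤ j then KL k (m + 1) (k - 1) else 0)))
    (hSc : ∀ i m j, 1 ≤ i → i ≤ K - 1 → m + 1 + K ≤ j → ∀ L', L' < K →
      ∑ l ∈ Ico L' K, HgS (i - 1) j (m + 1 + l) * KA i (m + 1) l ≤ ∑ l ∈ Ico L' K, KA i m l)
    (hScp : ∀ i m L₀, 1 ≤ i → i ≤ K - 1 → L₀ < K → ∀ L', L' ≤ L₀ →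
      ∑ l ∈ Ico L' L₀, HgS (i - 1) (m + 1 + L₀) (m + 1 + l) * KA i (m + 1) l ≤ ∑ l ∈ Ico L' (L₀ + 1), KA i m l)
    {e ε : ℕ → ℝ} (he0 : ∀ m, 0 ≤ e m) (hea : ∀ m, e (m + 1) ≤ e m) (het : ∀ m, K < m → e m = 0)
    (hεt : ∀ m, K < m → ε m = 0) (hεrec : ∀ m, ε m = e m - RA 1 ε m) : ∀ m, 0 ≤ ε m := by
  have hkK : k < K := by omega
  have hKk' : K - 1 = k := by omega
  obtain ⟨h1, h1p⟩ := flow_hSb_one hmono hL hb hlo hdom hh hf hg hgF hk2 hkK hL2 hKL hθ hρ hβnew hβold hH hM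
  refine flow_nonneg_of_static_families_oldest hmono hL hb hlo hdom hh hf hg hgF (by omega) hKL hθ hRL hRA hKA hKAtop hSL hSA hρ hβnew hβold
    (fun k' n hk'2 hk'K => ?_) hH hM (fun i m hi1 hiK L' hL' => ?_) (fun i m hi1 hiK L₀ hL₀ L' hL' => ?_) (by rw [hKk']; exact hold2)
    hHS hSc hScp he0 hea het hεt hεrec
  · by_cases hkk : k' = k
    · subst hkk; exact hrowk n
    · exact silent_row hKL (hL2 k' hk'K (by omega) hkk) n
  · rcases Nat.lt_or_ge i 2 with hi | hi
    · obtain rfl : i = 1 := by omega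
      exact h1 m L' hL'
    · exact silent_tail_sums hKL (hL2 i (by omega) (by omega) (by omega)) m _ _
  · rcases Nat.lt_or_ge i 2 with hi | hi
    · obtain rfl : i = 1 := by omega
      exact h1p m L₀ hL₀ L' hL'
    · exact silent_tail_sums hKL (hL2 i (by omega) (by omega) (by omega)) m _ _

end Summit.QuantumFields.BalabanUV.Beta.EriceRemainderEnclosureHistoryAutonomyComparisonAgeCompositionStaticEndOldestFlow

end
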